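import Summits.ValiantsHypothesis.ValiantsHypothesis.Theorems.KPlusLogSqLawTropicalBDisjointDeviations

/-!
# Route «KPlusLogSqLaw», crux `TropicalB` (stmt-ValiantsHypothesis-19771) — THE WINDOW LAW: steps of a dominant chain confined to a column
# window `J₀` number at most the distinct `J₀`-patterns of the chain, hence at most `(m·K)^{|J₀|}`; short-step chains are `≤ C(m,ℓ)·(mK)^ℓ`

HONEST FRAMING.  Part 4 of the long-range atom laws (seat val-sym-trop-p1 g21, cell `pub-symmetroid`, 2026-08-28; `--supports
stmt-ValiantsHypothesis-19771 --as helper`).  A quantitative corollary of the SUNFLOWER LAW (part 3, `sunflower_after`) valid for every dominance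
design at every format, no hypothesis on exponents / valuations / support / signs / tightness.  It sharpens the kernel's short-step count
`chain_le_pow_of_changes` (…TropicalBFreshExchanges, val-sym-trop-p5: `n ≤ (m·(mK)²)^ℓ` when every step changes `≤ ℓ` columns) to
`n ≤ C(m, ℓ)·(mK)^ℓ` — for `ℓ = 1` this is `m²K`, the order of the true maximum `m(K−1)` of pure re-classing chains.  Polynomial-regime
bookkeeping: nothing here bounds `TropicalB` in its window or bears on `WeakLifting`, DoorA26 / DoorA34, `MatrixDescartes`
(stmt-ValiantsHypothesis-18050) or VP ≠ VNP.

THE LAW.  Let `p₀ ≺ … ≺ pₙ` be dominant at strictly increasing integer slopes with distinct consecutive terms, `J₀` a set of columns.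
* `pattern_ne_of_step_inside` — **NO RETURN**: if the step `p_k → p_{k+1}` changes only columns of `J₀`, then NO later term `p_j` (`j > k`) carries the
  `J₀`-pattern of `p_k` (its (row, class) data on `J₀`, as a function `J₀ → Fin m × Fin K`): by the sunflower law `Δ(p_k, p_{k+1}) ∩ Δ(p_k, p_j) ≠ ∅`, and the first set lies in `J₀`.
* `card_steps_inside_le_card_image` — **WINDOW LAW**: the steps confined to `J₀` number at most the number of distinct `J₀`-patterns along the chain;
  `card_steps_inside_le_pow`: hence at most `(m·K)^{|J₀|}`.
* `chain_le_choose_mul_pow` — **SHORT-STEP CHAINS**: if every step changes at most `ℓ ≤ m` columns then `n ≤ C(m, ℓ)·(m·K)^ℓ`;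
  signed form `chain_le_choose_mul_pow_alt`.
[exchange argument + pigeonhole; the packaging is this cell's, no citation exists]
-/

set_option linter.dupNamespace false
set_option autoImplicit false

namespace Summit.ValiantsHypothesis.ValiantsHypothesis.Theorems.KPlusLogSqLaw.LongRangeAtom

open Summit.ValiantsHypothesis.ValiantsHypothesis.Theorems.MatrixDescartes.Negative
open Summit.ValiantsHypothesis.ValiantsHypothesis.Theorems.LacunarySymmetroidMatrixDescartes
open Summit.ValiantsHypothesis.ValiantsHypothesis.Theorems.LacunarySymmetroidMatrixDescartes.TropicalCensus
open Summit.ValiantsHypothesis.ValiantsHypothesis.Theorems.KPlusLogSqLaw.Sumset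
open Summit.ValiantsHypothesis.ValiantsHypothesis.Theorems.KPlusLogSqLaw.AtomBudget
open scoped BigOperators
open Finset

variable {m K : ℕ}

section Chain

variable (d : Fin K → ℕ) (v ε : Fin m → Fin m → Fin K → ℤ) {n : ℕ}
  (θ : Fin (n + 1) → ℤ) (p : Fin (n + 1) → Equiv.Perm (Fin m) × (Fin m → Fin K))

/-- **NO RETURN.**  If the step `p_k → p_{k+1}` of a dominant chain changes only columns inside `J₀`, then no later term carries the
`J₀`-pattern of `p_k`. [this cell] -/
theorem pattern_ne_of_step_inside (hθ : StrictMono θ) (hdom : ∀ k, IsDominant d v ε (θ k) (p k))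
    (hne : ∀ k : Fin n, p k.castSucc ≠ p k.succ) (J₀ : Finset (Fin m)) (k : Fin n)
    (hin : ∀ b, b ∉ J₀ → (p k.castSucc).1 b = (p k.succ).1 b ∧ (p k.castSucc).2 b = (p k.succ).2 b)
    {j : Fin (n + 1)} (hj : k.castSucc < j) : (fun b : J₀ => ((p k.castSucc).1 b, (p k.castSucc).2 b)) ≠ fun b : J₀ => ((p j).1 b, (p j).2 b) := by
  intro heq
  obtain ⟨b, hb1, hb2⟩ := sunflower_after d v ε θ p hθ hdom hne (Fin.castSucc_lt_succ (i := k)) hj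
  -- the changed column `b` of the step lies in `J₀`
  have hbJ : b ∈ J₀ := by
    by_contra hb
    obtain ⟨h1, h2⟩ := hin b hb
    rcases hb1 with h | h
    · exact h h1
    · exact h h2
  -- but the patterns agree at `b`
  have := congrFun heq ⟨b, hbJ⟩
  simp only [Prod.mk.injEq] at this
  rcases hb2 with h | h
  · exact h this.1
  · exact h this.2

/-- **WINDOW LAW.**  The steps of a dominant chain confined to the column window `J₀` number at most the distinct `J₀`-patterns along the
chain. [this cell] -/
theorem card_steps_inside_le_card_image (hθ : StrictMono θ) (hdom : ∀ k, IsDominant d v ε (θ k) (p k))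
    (hne : ∀ k : Fin n, p k.castSucc ≠ p k.succ) (J₀ : Finset (Fin m)) :
    (univ.filter fun k : Fin n =>
        ∀ b, b ∉ J₀ → (p k.castSucc).1 b = (p k.succ).1 b ∧ (p k.castSucc).2 b = (p k.succ).2 b).card ≤
      (univ.image fun k : Fin (n + 1) => fun b : J₀ => ((p k).1 b, (p k).2 b)).card := by
  classical
  set I := univ.filter fun k : Fin n =>
      ∀ b, b ∉ J₀ → (p k.castSucc).1 b = (p k.succ).1 b ∧ (p k.castSucc).2 b = (p k.succ).2 b with hI
  -- `k ↦ pattern (p k.castSucc)` is injective on `I`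
  have hinj : Set.InjOn (fun k : Fin n => fun b : J₀ => ((p k.castSucc).1 b, (p k.castSucc).2 b)) I := by
    intro k hk k' hk' heq
    by_contra hkk
    rcases lt_or_gt_of_ne hkk with hlt | hgt
    · have hlt' : k.castSucc < k'.castSucc := Fin.castSucc_lt_castSucc_iff.mpr hlt
      exact pattern_ne_of_step_inside d v ε θ p hθ hdom hne J₀ k (Finset.mem_filter.mp (Finset.mem_coe.mp hk)).2 hlt' heq
    · have hgt' : k'.castSucc < k.castSucc := Fin.castSucc_lt_castSucc_iff.mpr hgt
      exact pattern_ne_of_step_inside d v ε θ p hθ hdom hne J₀ k' (Finset.mem_filter.mp (Finset.mem_coe.mp hk')).2 hgt' heq.symm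
  calc I.card = (I.image fun k : Fin n => fun b : J₀ => ((p k.castSucc).1 b, (p k.castSucc).2 b)).card :=
        (Finset.card_image_of_injOn hinj).symm
    _ ≤ (univ.image fun k : Fin (n + 1) => fun b : J₀ => ((p k).1 b, (p k).2 b)).card := by
        refine Finset.card_le_card fun x hx => ?_
        obtain ⟨k, -, rfl⟩ := Finset.mem_image.mp hx
        exact Finset.mem_image.mpr ⟨k.castSucc, Finset.mem_univ _, rfl⟩

/-- **WINDOW LAW (counted).**  The steps of a dominant chain confined to a window `J₀` number at most `(m·K)^{|J₀|}`. [this cell] -/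
theorem card_steps_inside_le_pow (hθ : StrictMono θ) (hdom : ∀ k, IsDominant d v ε (θ k) (p k))
    (hne : ∀ k : Fin n, p k.castSucc ≠ p k.succ) (J₀ : Finset (Fin m)) :
    (univ.filter fun k : Fin n =>
        ∀ b, b ∉ J₀ → (p k.castSucc).1 b = (p k.succ).1 b ∧ (p k.castSucc).2 b = (p k.succ).2 b).card ≤ (m * K) ^ J₀.card := by
  classical
  refine (card_steps_inside_le_card_image d v ε θ p hθ hdom hne J₀).trans ?_
  calc (univ.image fun k : Fin (n + 1) => fun b : J₀ => ((p k).1 b, (p k).2 b)).card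
      ≤ (univ : Finset (J₀ → Fin m × Fin K)).card := Finset.card_le_card (Finset.subset_univ _)
    _ = (m * K) ^ J₀.card := by
        rw [Finset.card_univ, Fintype.card_fun, Fintype.card_prod, Fintype.card_fin, Fintype.card_fin, Fintype.card_coe]

/-- **SHORT-STEP CHAINS.**  If every step of a dominant chain (distinct consecutive terms) changes at most `ℓ ≤ m` columns, then
`n ≤ C(m, ℓ)·(m·K)^ℓ` (sharpening the kernel's `(m·(mK)²)^ℓ` of …TropicalBFreshExchanges). [this cell] -/
theorem chain_le_choose_mul_pow (hθ : StrictMono θ) (hdom : ∀ k, IsDominant d v ε (θ k) (p k))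
    (hne : ∀ k : Fin n, p k.castSucc ≠ p k.succ) {ℓ : ℕ} (hℓ : ℓ ≤ m)
    (hshort : ∀ k : Fin n, ∃ J : Finset (Fin m), J.card ≤ ℓ ∧
      ∀ b, b ∉ J → (p k.castSucc).1 b = (p k.succ).1 b ∧ (p k.castSucc).2 b = (p k.succ).2 b) :
    n ≤ m.choose ℓ * (m * K) ^ ℓ := by
  classical
  -- every step is confined to some window of size exactly `ℓ`
  have hwin : ∀ k : Fin n, ∃ J₀ ∈ (univ : Finset (Fin m)).powersetCard ℓ,
      ∀ b, b ∉ J₀ → (p k.castSucc).1 b = (p k.succ).1 b ∧ (p k.castSucc).2 b = (p k.succ).2 b := by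
    intro k
    obtain ⟨J, hJ, hJin⟩ := hshort k
    obtain ⟨J₀, hJJ₀, hJ₀u, hcard⟩ : ∃ J₀, J ⊆ J₀ ∧ J₀ ⊆ univ ∧ J₀.card = ℓ :=
      Finset.exists_subsuperset_card_eq (Finset.subset_univ J) hJ (by rw [Finset.card_univ, Fintype.card_fin]; exact hℓ)
    exact ⟨J₀, Finset.mem_powersetCard.mpr ⟨hJ₀u, hcard⟩, fun b hb => hJin b fun hbJ => hb (hJJ₀ hbJ)⟩
  have hcover : (univ : Finset (Fin n)) ⊆ ((univ : Finset (Fin m)).powersetCard ℓ).biUnion fun J₀ =>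
      univ.filter fun k : Fin n =>
        ∀ b, b ∉ J₀ → (p k.castSucc).1 b = (p k.succ).1 b ∧ (p k.castSucc).2 b = (p k.succ).2 b := by
    intro k _
    obtain ⟨J₀, hJ₀, hk⟩ := hwin k
    exact Finset.mem_biUnion.mpr ⟨J₀, hJ₀, Finset.mem_filter.mpr ⟨Finset.mem_univ _, hk⟩⟩
  calc n = (univ : Finset (Fin n)).card := by rw [Finset.card_univ, Fintype.card_fin]
    _ ≤ (((univ : Finset (Fin m)).powersetCard ℓ).biUnion fun J₀ => univ.filter fun k : Fin n =>
          ∀ b, b ∉ J₀ → (p k.castSucc).1 b = (p k.succ).1 b ∧ (p k.castSucc).2 b = (p k.succ).2 b).card :=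
        Finset.card_le_card hcover
    _ ≤ ∑ J₀ ∈ (univ : Finset (Fin m)).powersetCard ℓ, (univ.filter fun k : Fin n =>
          ∀ b, b ∉ J₀ → (p k.castSucc).1 b = (p k.succ).1 b ∧ (p k.castSucc).2 b = (p k.succ).2 b).card :=
        Finset.card_biUnion_le
    _ ≤ ∑ J₀ ∈ (univ : Finset (Fin m)).powersetCard ℓ, (m * K) ^ ℓ := by
        refine Finset.sum_le_sum fun J₀ hJ₀ => ?_
        have hc : J₀.card = ℓ := (Finset.mem_powersetCard.mp hJ₀).2
        rw [← hc]
        exact card_steps_inside_le_pow d v ε θ p hθ hdom hne J₀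
    _ = m.choose ℓ * (m * K) ^ ℓ := by
        rw [Finset.sum_const, smul_eq_mul, Finset.card_powersetCard, Finset.card_univ, Fintype.card_fin]

/-- **short-step chains, signed hypotheses of `TropRow`.** [this cell] -/
theorem chain_le_choose_mul_pow_alt (hθ : StrictMono θ) (hdom : ∀ k, IsDominant d v ε (θ k) (p k))
    (halt : ∀ k : Fin n, termSign ε (p k.castSucc) * termSign ε (p k.succ) < 0) {ℓ : ℕ} (hℓ : ℓ ≤ m)
    (hshort : ∀ k : Fin n, ∃ J : Finset (Fin m), J.card ≤ ℓ ∧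
      ∀ b, b ∉ J → (p k.castSucc).1 b = (p k.succ).1 b ∧ (p k.castSucc).2 b = (p k.succ).2 b) :
    n ≤ m.choose ℓ * (m * K) ^ ℓ :=
  chain_le_choose_mul_pow d v ε θ p hθ hdom (ne_succ_of_alternating ε p halt) hℓ hshort

end Chain

end Summit.ValiantsHypothesis.ValiantsHypothesis.Theorems.KPlusLogSqLaw.LongRangeAtom
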